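import Mathlib.Combinatorics.SimpleGraph.Finite
import Mathlib.Combinatorics.SimpleGraph.Connectivity.Connected
import Mathlib.Combinatorics.SimpleGraph.Maps
import Mathlib.Data.Sym.Sym2
import Mathlib.Algebra.Ring.Parity
import Mathlib.Data.Fintype.Sum
import Mathlib.Data.Fintype.Sigma
import HarnessLib

/-!
# The Cai–Fürer–Immerman graphs `CFI(G, T)`

Topic `Literature/ModelTheory/FiniteModelTheory`; part of definition request `wi-03769` (route
PneNP/Descriptive crux #2: the CFI query separates FO(LFP)+C from `P`; base of Lichter's 2021
separation of rank logic).

For a finite simple base graph `G` on `Fin v` and a set `T` of TWISTED edges, the CFI graph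
`cfiGraph G T` (Cai–Fürer–Immerman 1992, §6; Dawar–Richerby–Rossman 2008, §2; Lichter 2021, §2)
has
* GADGET (inner) vertices `m_{u,S}` for every vertex `u` and every EVEN-size subset `S` of the
  neighbourhood `N(u)`;
* END (outer) vertices `a_{u,w}` (`= (u,w,1)`) and `b_{u,w}` (`= (u,w,0)`) for every ordered
  adjacent pair `(u, w)`;
* edges `m_{u,S} — a_{u,w}` for `w ∈ S`, `m_{u,S} — b_{u,w}` for `w ∈ N(u) ∖ S`, and, for every
  edge `{u,w}` of `G`, the connections `a_{u,w} — a_{w,u}`, `b_{u,w} — b_{w,u}` if `{u,w} ∉ T`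
  (straight) resp. `a_{u,w} — b_{w,u}`, `b_{u,w} — a_{w,u}` if `{u,w} ∈ T` (twisted).
For connected `G` the isomorphism type of `CFI(G, T)` depends only on the parity of `|T|`
(loc. cit.); the EVEN and ODD CFI graphs over `G` are not isomorphic, are told apart in
polynomial time (given the gadget structure), but not by `C^k_{∞ω}` for `k` below the treewidth
of `G` — the Cai–Fürer–Immerman theorem (facts for a later item; only DEFINITIONS here).

* `CFIVertex G`, `cfiRel G T`, `cfiGraph G T : SimpleGraph (CFIVertex G)` (via
  `SimpleGraph.fromRel`, so symmetric and loopless by construction), `Fintype` instance;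
* `cfiFinGraph G T : Σ n, SimpleGraph (Fin n)` — the same graph transported to `Fin n`
  (`Fintype.equivFin`), the format of the tree's graph encodings/classes;
* `IsCFIOf G H` (H is isomorphic to some `CFI(G, T)`), `IsEvenCFIOf`, `IsOddCFIOf`, and the
  CFI QUERY `cfiQuery = {H | ∃ v, ∃ G connected on Fin v, IsEvenCFIOf G H}`.

## References

* J.-Y. Cai, M. Fürer, N. Immerman, *An optimal lower bound on the number of variables for graph
  identification*, Combinatorica 12 (1992) 389–410, §6.
* A. Dawar, D. Richerby, B. Rossman, *Choiceless polynomial time, counting and the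
  Cai–Fürer–Immerman graphs*, Ann. Pure Appl. Logic 152 (2008), §2.
* M. Lichter, *Separating rank logic from polynomial time*, LICS 2021, arXiv:2107.03778, §2
  (CFI graphs, generalised CFI over `ℤ_{2^q}`).
-/

namespace Literature.ModelTheory.FiniteModelTheory

open Finset

variable {v : ℕ} (G : SimpleGraph (Fin v)) [DecidableRel G.Adj]

/-- The vertices of `CFI(G, ·)`: gadget vertices `m_{u,S}` (`S ⊆ N(u)`, `|S|` even) and end
vertices `(u, w, c)` for adjacent `u, w` (`c = true`: `a_{u,w}`, `c = false`: `b_{u,w}`).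
[Cai–Fürer–Immerman 1992, §6; Dawar–Richerby–Rossman 2008, §2] [cite: CaiFurerImmerman1992, §6] -/
def CFIVertex : Type :=
  (Σ u : Fin v, {S : Finset (Fin v) // S ⊆ G.neighborFinset u ∧ Even S.card}) ⊕
    ({p : Fin v × Fin v // G.Adj p.1 p.2} × Bool)

/-- `CFIVertex G` is finite. [folklore] -/
noncomputable instance : Fintype (CFIVertex G) := by
  classical
  unfold CFIVertex; infer_instance

/-- `CFIVertex G` has decidable equality. [folklore] -/
noncomputable instance : DecidableEq (CFIVertex G) := by
  classical
  unfold CFIVertex; infer_instance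

/-- The (directed generating) adjacency of `CFI(G, T)`, `T` the set of twisted edges: gadget–end
edges `m_{u,S} → (u, w, [w ∈ S])`, and end–end connections `(u, w, c) → (w, u, c')` with
`c = c'` iff `{u,w}` is straight (`∉ T`). Symmetrised by `SimpleGraph.fromRel` in `cfiGraph`.
[Cai–Fürer–Immerman 1992, §6; Lichter 2021, §2] [cite: CaiFurerImmerman1992, §6] -/
def cfiRel (T : Set (Sym2 (Fin v))) [DecidablePred (· ∈ T)] : CFIVertex G → CFIVertex G → Prop
  | .inl ⟨u, S⟩, .inr (⟨(u', w), _⟩, c) => u = u' ∧ (c = true ↔ w ∈ S.1)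
  | .inr (⟨(u, w), _⟩, c), .inr (⟨(w', u'), _⟩, c') =>
      w' = w ∧ u' = u ∧ (c = c' ↔ s(u, w) ∉ T)
  | _, _ => False

/-- **The CFI graph `CFI(G, T)`** with twisted edge set `T`. [Cai–Fürer–Immerman 1992, §6;
Dawar–Richerby–Rossman 2008, §2; Lichter 2021, §2] [cite: CaiFurerImmerman1992, §6] -/
def cfiGraph (T : Set (Sym2 (Fin v))) [DecidablePred (· ∈ T)] : SimpleGraph (CFIVertex G) :=
  SimpleGraph.fromRel (cfiRel G T)

/-- The untwisted (EVEN) CFI graph `CFI(G, ∅)`. [Cai–Fürer–Immerman 1992, §6] [cite: CaiFurerImmerman1992, §6] -/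
def cfiEven : SimpleGraph (CFIVertex G) :=
  cfiGraph G (∅ : Set (Sym2 (Fin v)))

/-- `CFI(G, T)` transported to the vertex set `Fin n`, `n = |CFIVertex G|` (the format
`Σ n, SimpleGraph (Fin n)` of the tree's graph classes/encodings). [folklore] -/
noncomputable def cfiFinGraph (T : Set (Sym2 (Fin v))) [DecidablePred (· ∈ T)] :
    Σ n : ℕ, SimpleGraph (Fin n) :=
  ⟨Fintype.card (CFIVertex G), (cfiGraph G T).map (Fintype.equivFin (CFIVertex G)).toEmbedding⟩

/-- `H` (on `Fin n`) IS A CFI GRAPH OVER `G`: isomorphic to `CFI(G, T)` for some set `T` of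
twisted EDGES of `G` (`T ⊆ G.edgeFinset`; `cfiGraph` only reads `T` on edges, `cfiGraph_congr`).
[Cai–Fürer–Immerman 1992, §6] [folklore] -/
def IsCFIOf (H : Σ n : ℕ, SimpleGraph (Fin n)) : Prop :=
  ∃ T : Finset (Sym2 (Fin v)), T ⊆ G.edgeFinset ∧
    Nonempty (H.2 ≃g cfiGraph G (↑T : Set (Sym2 (Fin v))))

/-- `H` is an EVEN CFI graph over `G` (an even number of twisted EDGES, `T ⊆ G.edgeFinset`; for connected `G` all these are
isomorphic to `CFI(G, ∅)`). [Cai–Fürer–Immerman 1992, §6 (Lemma 6.2: parity determines the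
isomorphism type)] [folklore] -/
def IsEvenCFIOf (H : Σ n : ℕ, SimpleGraph (Fin n)) : Prop :=
  ∃ T : Finset (Sym2 (Fin v)), T ⊆ G.edgeFinset ∧ Even T.card ∧
    Nonempty (H.2 ≃g cfiGraph G (↑T : Set (Sym2 (Fin v))))

/-- `H` is an ODD CFI graph over `G` (an odd number of twisted edges, `T ⊆ G.edgeFinset`).
[Cai–Fürer–Immerman 1992, §6] [folklore] -/
def IsOddCFIOf (H : Σ n : ℕ, SimpleGraph (Fin n)) : Prop :=
  ∃ T : Finset (Sym2 (Fin v)), T ⊆ G.edgeFinset ∧ Odd T.card ∧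
    Nonempty (H.2 ≃g cfiGraph G (↑T : Set (Sym2 (Fin v))))

/-- **The CFI query**: the finite graphs isomorphic to an EVEN CFI graph over some CONNECTED
base graph. This is the UNCOLOURED variant: Cai–Fürer–Immerman (§6) and Dawar–Richerby–Rossman
work with coloured/ordered gadgets (or base graphs of minimum degree ≥ 2 with a linear order);
facts about this query (parity determines the isomorphism type for connected `G`; even ≇ odd;
polynomial-time decidability; non-definability in FO(LFP)+C) must carry the hypotheses under
which the cited proofs apply to the uncoloured graphs — none is asserted here.
[Cai–Fürer–Immerman 1992, §6–7;
Dawar–Richerby–Rossman 2008, §2] [cite: CaiFurerImmerman1992, §6] -/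
def cfiQuery : Set (Σ n : ℕ, SimpleGraph (Fin n)) :=
  {H | ∃ (v : ℕ) (G : SimpleGraph (Fin v)) (_ : DecidableRel G.Adj), G.Connected ∧ IsEvenCFIOf G H}

/-! ### API -/

variable (T : Set (Sym2 (Fin v))) [DecidablePred (· ∈ T)]

/-- Gadget vertices are pairwise non-adjacent (the inner vertices form an independent set).
[Cai–Fürer–Immerman 1992, §6] [folklore] -/
theorem cfiGraph_not_adj_inl_inl (x y : Σ u : Fin v, {S : Finset (Fin v) // S ⊆ G.neighborFinset u ∧ Even S.card}) :
    ¬ (cfiGraph G T).Adj (.inl x) (.inl y) := by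
  rintro ⟨-, h | h⟩ <;> · obtain ⟨u, S⟩ := x; obtain ⟨u', S'⟩ := y; exact h

/-- A gadget vertex `m_{u,S}` is adjacent to the end vertex `(u, w, c)` iff `c` records
membership of `w` in `S`. [Cai–Fürer–Immerman 1992, §6] [folklore] -/
theorem cfiGraph_adj_inl_inr (u : Fin v) (S : {S : Finset (Fin v) // S ⊆ G.neighborFinset u ∧ Even S.card})
    (p : {p : Fin v × Fin v // G.Adj p.1 p.2}) (c : Bool) :
    (cfiGraph G T).Adj (.inl ⟨u, S⟩) (.inr (p, c)) ↔ u = p.1.1 ∧ (c = true ↔ p.1.2 ∈ S.1) := by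
  obtain ⟨⟨u', w⟩, hp⟩ := p
  simp only [cfiGraph, SimpleGraph.fromRel_adj, ne_eq, reduceCtorEq, not_false_eq_true, true_and]
  constructor
  · rintro (h | h)
    · exact h
    · exact h.elim
  · exact fun h => Or.inl h

/-- The empty twist set gives `cfiEven`. [folklore] -/
theorem cfiGraph_empty : cfiGraph G (∅ : Set (Sym2 (Fin v))) = cfiEven G := rfl

/-- `cfiRel` only reads the twist set on EDGES of `G`. [folklore] -/
theorem cfiRel_congr {T T' : Set (Sym2 (Fin v))} [DecidablePred (· ∈ T)] [DecidablePred (· ∈ T')]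
    (h : ∀ u w : Fin v, G.Adj u w → (s(u, w) ∈ T ↔ s(u, w) ∈ T')) : cfiRel G T = cfiRel G T' := by
  funext a b
  rcases a with ⟨u, S⟩ | ⟨⟨⟨u, w⟩, huw⟩, c⟩ <;> rcases b with ⟨u', S'⟩ | ⟨⟨⟨w', u'⟩, hwu⟩, c'⟩ <;>
    simp only [cfiRel]
  rw [h u w huw]

/-- Hence `CFI(G, T)` depends only on `T ∩ E(G)`: consumers may assume `T ⊆ G.edgeSet`.
[folklore] -/
theorem cfiGraph_congr {T T' : Set (Sym2 (Fin v))} [DecidablePred (· ∈ T)] [DecidablePred (· ∈ T')]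
    (h : ∀ u w : Fin v, G.Adj u w → (s(u, w) ∈ T ↔ s(u, w) ∈ T')) : cfiGraph G T = cfiGraph G T' := by
  rw [cfiGraph, cfiGraph, cfiRel_congr G h]

/-- In particular `CFI(G, T) = CFI(G, T ∩ E(G))`. [folklore] -/
theorem cfiGraph_eq_inter_edgeSet (T : Set (Sym2 (Fin v))) [DecidablePred (· ∈ T)]
    [DecidablePred (· ∈ T ∩ G.edgeSet)] : cfiGraph G T = cfiGraph G (T ∩ G.edgeSet) :=
  cfiGraph_congr G fun u w huw => by simp [SimpleGraph.mem_edgeSet, huw]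

/-- `CFI(G, T)` for a set `T` of edges is a CFI graph over `G` in the sense of `IsCFIOf`
(transport along `Fintype.equivFin`). [folklore] -/
theorem isCFIOf_cfiFinGraph (T : Finset (Sym2 (Fin v))) (hT : T ⊆ G.edgeFinset) :
    IsCFIOf G (cfiFinGraph G (↑T : Set (Sym2 (Fin v)))) := by
  refine ⟨T, hT, ⟨?_⟩⟩
  exact (SimpleGraph.Iso.map (Fintype.equivFin (CFIVertex G)) (cfiGraph G (↑T : Set _))).symm

/-- The untwisted CFI graph is an EVEN CFI graph over its base (`T = ∅`, zero twists). [folklore] -/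
theorem isEvenCFIOf_cfiFinGraph_empty :
    IsEvenCFIOf G (cfiFinGraph G ((∅ : Finset (Sym2 (Fin v))) : Set (Sym2 (Fin v)))) :=
  ⟨∅, Finset.empty_subset _, ⟨0, rfl⟩,
    ⟨(SimpleGraph.Iso.map (Fintype.equivFin (CFIVertex G)) (cfiGraph G _)).symm⟩⟩

/-- Non-vacuity: over the one-edge base graph `K₂`, the gadget vertex `m_{0,∅}` of `CFI(K₂, ∅)`
is adjacent to the end vertex `b_{0,1}`. [Cai–Fürer–Immerman 1992, §6] [folklore] -/
example : (cfiEven (⊤ : SimpleGraph (Fin 2))).Adj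
    (.inl ⟨0, ⟨∅, Finset.empty_subset _, by simp⟩⟩)
    (.inr (⟨(0, 1), by simp⟩, false)) := by
  rw [← cfiGraph_empty, cfiGraph_adj_inl_inr]
  simp

end Literature.ModelTheory.FiniteModelTheory
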